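import Literature.MathematicalPhysics.KineticTheory.HardSphereCollisionFluxBackward
import Literature.Analysis.FluidPDE.HardSphereWindowEvent
import Literature.Analysis.FluidPDE.HardSphereScattering
import HarnessLib

/-!
# The single-collision events in collision coordinates
(Cercignani–Illner–Pulvirenti 1994 App. 4.A–4.B; trunk T-KINETIC, topic
MathematicalPhysics/KineticTheory; step C3c of the plan for the one-step mild BBGKY hierarchy
almost everywhere, input (H1) of `hs_seriesFamily_ae_eq_of_oneStep`.)

For the single-collision event `singleCollisionEvent` of a time window `(0, δ]` with colliding
pair (sphere `i`, last sphere) on `T^d` (`HardSphereWindowEvent`), this file identifies the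
data of the event with the collision coordinates of `HardSphereCollisionFluxBackward`:

* `chart_of_mem_singleCollisionEvent` — if the flipped chart configuration
  `flipVel (appendParticle W' (x'_i + proj r) w)`, `r ∈ (-1/2, 1/2]^d`, belongs to the event and
  its colliding pair is slow (`‖w - v'_i‖ ≤ V`, `ε + δ V ≤ ρ < 1/2`), then
  `r = ε ν + t₁ (w - v'_i)` for a unit `ν` with `⟪w - v'_i, ν⟫ > 0`, `t₁` the collision instant
  (uniqueness of the representative of a point of the torus in the cube): the chart support
  hypothesis of `lintegral_eq_boundaryFlux_backward` holds for integrands supported in the slow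
  part of the event (`chart_support_of_singleCollisionEvent`);
* `collisionInstant_eq_of_chart` — in the collision coordinates `r = ε ν + τ u` the collision
  instant of such a datum is `τ` (injectivity of the collision cylinder map).

## References

* C. Cercignani, R. Illner, M. Pulvirenti, *The Mathematical Theory of Dilute Gases*, Springer
  (1994), App. 4.A pp. 107–111, App. 4.B.
-/

open MeasureTheory MeasureTheory.Measure Metric Real Set Filter Function
open scoped ENNReal InnerProductSpace
open Literature.Analysis.FluidPDE Literature.Analysis

namespace Literature.MathematicalPhysics.KineticTheory

noncomputable section

section Kinetic

variable {d : Type*} [Fintype d]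

section Chart

variable {ε : ℝ} (hε : 0 < ε) (hε' : ε < 2⁻¹) {s : ℕ} (i : Fin (s + 1))

include hε hε'

/-- **The chart coordinates of a datum of the single-collision event.** Let
`z = flipVel (appendParticle W' (x'_i + proj r) w)` with `r` in the cube `(-1/2, 1/2]^d` belong to
the single-collision event of the window `(0, δ]` for the pair (`i`, last sphere), with slow
colliding pair `‖w - v'_i‖ ≤ V` and `ε + δ V ≤ ρ < 1/2`. Then `r = ε ν + t₁(z) (w - v'_i)` for a
unit vector `ν` with `⟪w - v'_i, ν⟫ > 0`: at the collision instant `t₁ = t₁(z) ≤ δ` the minimal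
image of `x_i - x_last` is `reprSym (proj (t₁ (w - v'_i) - r)) =: q₀` with `‖q₀‖ = ε` and
`⟪q₀, w - v'_i⟫ < 0` (incoming), and `r`, `t₁ (w - v'_i) - q₀` are two representatives in the cube
of the same point of the torus. [cite: CIP1994, App. 4.A pp. 108–111] -/
theorem chart_of_mem_singleCollisionEvent {ρ δ V : ℝ} (hρ : ρ < 1 / 2) (hδV : ε + δ * V ≤ ρ)
    (W' : Config (s + 1) d (UnitAddTorus d)) (w r : EuclideanSpace ℝ d) (hr : r ∈ Torus.symCube d)
    (hmem : flipVel (appendParticle W' ((W' i).1 + FunctionSpaces.Torus.proj r) w) ∈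
      Alexander.singleCollisionEvent (Torus.geometry d) ε (Fin.castAdd 1 i) (Fin.natAdd (s + 1) 0) δ)
    (hslow : ‖w - (W' i).2‖ ≤ V) :
    ∃ ν : sphere (0 : EuclideanSpace ℝ d) 1, 0 < ⟪w - (W' i).2, (ν : EuclideanSpace ℝ d)⟫_ℝ ∧
      r = ε • (ν : EuclideanSpace ℝ d) +
        (Alexander.collisionInstant (Torus.geometry d) ε (flipVel (appendParticle W' ((W' i).1 + FunctionSpaces.Torus.proj r) w)) 1).toReal •
          (w - (W' i).2) := by
  have hG := Torus.isHardSphereRegular_geometry (d := d) hε'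
  set z := flipVel (appendParticle W' ((W' i).1 + FunctionSpaces.Torus.proj r) w) with hz
  set t₁ := (Alexander.collisionInstant (Torus.geometry d) ε z 1).toReal with ht₁
  set u : EuclideanSpace ℝ d := w - (W' i).2 with hu
  have hne : (Fin.castAdd 1 i : Fin (s + 1 + 1)) ≠ Fin.natAdd (s + 1) 0 := by
    intro h
    have := congrArg Fin.val h
    simp at this
    omega
  obtain ⟨hτpos, hτle, ⟨p, hp, hpab⟩, -, -⟩ := Alexander.singleCollisionEvent_structure hG hne hmem
  have hc := hmem.2.2.2
  have hin := hp.isIncoming_of_mem_contactSet hG hne hc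
  -- the two particles of the exit configuration
  have hzi : z (Fin.castAdd 1 i) = ((W' i).1, -(W' i).2) := by
    rw [hz, flipVel_apply, appendParticle_castAdd]
  have hzl : z (Fin.natAdd (s + 1) 0) = ((W' i).1 + FunctionSpaces.Torus.proj r, -w) := by
    rw [hz, flipVel_apply, appendParticle_last]
  have hposi : (freeFlight (Torus.geometry d) t₁ z (Fin.castAdd 1 i)).1 =
      (W' i).1 + FunctionSpaces.Torus.proj (t₁ • (-(W' i).2)) := by
    rw [freeFlight_apply, hzi, Torus.geometry_translate]
  have hposl : (freeFlight (Torus.geometry d) t₁ z (Fin.natAdd (s + 1) 0)).1 =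
      (W' i).1 + FunctionSpaces.Torus.proj r + FunctionSpaces.Torus.proj (t₁ • (-w)) := by
    rw [freeFlight_apply, hzl, Torus.geometry_translate]
  have hveli : (freeFlight (Torus.geometry d) t₁ z (Fin.castAdd 1 i)).2 = -(W' i).2 := by
    rw [freeFlight_apply, hzi]
  have hvell : (freeFlight (Torus.geometry d) t₁ z (Fin.natAdd (s + 1) 0)).2 = -w := by
    rw [freeFlight_apply, hzl]
  -- the minimal image of `x_i - x_last` at the collision instant
  set q₀ : EuclideanSpace ℝ d := (Torus.geometry d).sepVec (freeFlight (Torus.geometry d) t₁ z (Fin.castAdd 1 i)).1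
    (freeFlight (Torus.geometry d) t₁ z (Fin.natAdd (s + 1) 0)).1 with hq₀
  have hps : ∀ a b : EuclideanSpace ℝ d,
      FunctionSpaces.Torus.proj (a - b) = FunctionSpaces.Torus.proj a - FunctionSpaces.Torus.proj b := fun _ _ => rfl
  have hq₀eq : q₀ = Torus.reprSym (FunctionSpaces.Torus.proj (t₁ • u - r)) := by
    rw [hq₀, Torus.geometry_sepVec, hposi, hposl]
    congr 1
    calc (W' i).1 + FunctionSpaces.Torus.proj (t₁ • -(W' i).2) -
          ((W' i).1 + FunctionSpaces.Torus.proj r + FunctionSpaces.Torus.proj (t₁ • -w))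
        = FunctionSpaces.Torus.proj (t₁ • -(W' i).2) - FunctionSpaces.Torus.proj r - FunctionSpaces.Torus.proj (t₁ • -w) := by abel
      _ = FunctionSpaces.Torus.proj (t₁ • -(W' i).2 - r - t₁ • -w) := by rw [hps, hps]
      _ = FunctionSpaces.Torus.proj (t₁ • u - r) := by congr 1; rw [hu]; module
  have hnorm : ‖q₀‖ = ε := hc.2
  have hinner : ⟪q₀, u⟫_ℝ < 0 := by
    have h := hin
    unfold IsIncoming at h
    rw [hveli, hvell] at h
    rwa [show -(W' i).2 - -w = u by rw [hu]; abel] at h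
  -- the unit vector
  have hq₀0 : q₀ ≠ 0 := by
    intro h; rw [h, norm_zero] at hnorm; exact hε.ne' hnorm.symm
  set ν : EuclideanSpace ℝ d := -(ε⁻¹ • q₀) with hν
  have hνn : ‖ν‖ = 1 := by
    rw [hν, norm_neg, norm_smul, norm_inv, Real.norm_of_nonneg hε.le, hnorm, inv_mul_cancel₀ hε.ne']
  have hνmem : ν ∈ sphere (0 : EuclideanSpace ℝ d) 1 := by simp [hνn]
  have hεν : ε • ν = -q₀ := by
    rw [hν, smul_neg, smul_smul, mul_inv_cancel₀ hε.ne', one_smul]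
  refine ⟨⟨ν, hνmem⟩, ?_, ?_⟩
  · -- the flux is positive
    show 0 < ⟪u, ν⟫_ℝ
    rw [hν, inner_neg_right, real_inner_smul_right, real_inner_comm]
    have : ε⁻¹ * ⟪q₀, u⟫_ℝ < 0 := mul_neg_of_pos_of_neg (inv_pos.2 hε) hinner
    linarith
  · -- two representatives in the cube of the same point of the torus
    show r = ε • ν + t₁ • u
    rw [hεν]
    have hproj : FunctionSpaces.Torus.proj r = FunctionSpaces.Torus.proj (-q₀ + t₁ • u) := by
      have h1 : FunctionSpaces.Torus.proj q₀ = FunctionSpaces.Torus.proj (t₁ • u - r) := by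
        rw [hq₀eq, Torus.proj_reprSym]
      rw [FunctionSpaces.Torus.proj_add, FunctionSpaces.Torus.proj_neg, h1, hps]
      abel
    have hsmall : -q₀ + t₁ • u ∈ Torus.symCube d := by
      refine Torus.closedBall_subset_symCube hρ ?_
      rw [mem_closedBall, dist_zero_right]
      calc ‖-q₀ + t₁ • u‖ ≤ ‖-q₀‖ + ‖t₁ • u‖ := norm_add_le _ _
        _ = ε + t₁ * ‖u‖ := by rw [norm_neg, hnorm, norm_smul, Real.norm_of_nonneg hτpos.le]
        _ ≤ ε + δ * V := by
            have : t₁ * ‖u‖ ≤ δ * V := mul_le_mul hτle hslow (norm_nonneg _) (hτpos.le.trans hτle)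
            linarith
        _ ≤ ρ := hδV
    calc r = Torus.reprSym (FunctionSpaces.Torus.proj r) := (Alexander.reprSym_proj_of_mem_symCube hr).symm
      _ = Torus.reprSym (FunctionSpaces.Torus.proj (-q₀ + t₁ • u)) := by rw [hproj]
      _ = -q₀ + t₁ • u := Alexander.reprSym_proj_of_mem_symCube hsmall

/-- **The collision instant in collision coordinates.** Under the hypotheses of
`chart_of_mem_singleCollisionEvent`, if `r = ε ν + τ (w - v'_i)` with a unit `ν`,
`⟪w - v'_i, ν⟫ > 0` and `τ > 0`, then the collision instant of the datum is `τ` (injectivity of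
the collision cylinder map, `injOn_collisionCylMap`). [folklore] -/
theorem collisionInstant_eq_of_chart {ρ δ V : ℝ} (hρ : ρ < 1 / 2) (hδV : ε + δ * V ≤ ρ)
    (W' : Config (s + 1) d (UnitAddTorus d)) (w : EuclideanSpace ℝ d) (ν : sphere (0 : EuclideanSpace ℝ d) 1) {τ : ℝ} (hτ : 0 < τ)
    (hflux : 0 < ⟪w - (W' i).2, (ν : EuclideanSpace ℝ d)⟫_ℝ)
    (hr : ε • (ν : EuclideanSpace ℝ d) + τ • (w - (W' i).2) ∈ Torus.symCube d)
    (hmem : flipVel (appendParticle W' ((W' i).1 + FunctionSpaces.Torus.proj (ε • (ν : EuclideanSpace ℝ d) + τ • (w - (W' i).2))) w) ∈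
      Alexander.singleCollisionEvent (Torus.geometry d) ε (Fin.castAdd 1 i) (Fin.natAdd (s + 1) 0) δ)
    (hslow : ‖w - (W' i).2‖ ≤ V) :
    (Alexander.collisionInstant (Torus.geometry d) ε
      (flipVel (appendParticle W' ((W' i).1 + FunctionSpaces.Torus.proj (ε • (ν : EuclideanSpace ℝ d) + τ • (w - (W' i).2))) w)) 1).toReal = τ := by
  obtain ⟨ν', hflux', hr'⟩ := chart_of_mem_singleCollisionEvent hε hε' i hρ hδV W' w _ hr hmem hslow
  set t₁ := (Alexander.collisionInstant (Torus.geometry d) ε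
      (flipVel (appendParticle W' ((W' i).1 + FunctionSpaces.Torus.proj (ε • (ν : EuclideanSpace ℝ d) + τ • (w - (W' i).2))) w)) 1).toReal
    with ht₁
  set u : EuclideanSpace ℝ d := w - (W' i).2 with hu
  have hG := Torus.isHardSphereRegular_geometry (d := d) hε'
  have hne : (Fin.castAdd 1 i : Fin (s + 1 + 1)) ≠ Fin.natAdd (s + 1) 0 := by
    intro h
    have := congrArg Fin.val h
    simp at this
    omega
  obtain ⟨hτpos, -, -, -, -⟩ := Alexander.singleCollisionEvent_structure hG hne hmem
  -- both `τ ν` and `t₁ ν'` are preimages of `r` under the collision cylinder map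
  have hνn : ‖(ν : EuclideanSpace ℝ d)‖ = 1 := by simp
  have hν'n : ‖(ν' : EuclideanSpace ℝ d)‖ = 1 := by simp
  have h1 : collisionCylMap ε u (τ • (ν : EuclideanSpace ℝ d)) = ε • (ν : EuclideanSpace ℝ d) + τ • u :=
    collisionCylMap_smul_unit ε u hνn hτ
  have h2 : collisionCylMap ε u (t₁ • (ν' : EuclideanSpace ℝ d)) = ε • (ν' : EuclideanSpace ℝ d) + t₁ • u :=
    collisionCylMap_smul_unit ε u hν'n hτpos
  have hd1 : τ • (ν : EuclideanSpace ℝ d) ∈ {y : EuclideanSpace ℝ d | 0 < ⟪u, y⟫_ℝ} := by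
    show 0 < ⟪u, τ • (ν : EuclideanSpace ℝ d)⟫_ℝ
    rw [real_inner_smul_right]; exact mul_pos hτ hflux
  have hd2 : t₁ • (ν' : EuclideanSpace ℝ d) ∈ {y : EuclideanSpace ℝ d | 0 < ⟪u, y⟫_ℝ} := by
    show 0 < ⟪u, t₁ • (ν' : EuclideanSpace ℝ d)⟫_ℝ
    rw [real_inner_smul_right]; exact mul_pos hτpos hflux'
  have heq : τ • (ν : EuclideanSpace ℝ d) = t₁ • (ν' : EuclideanSpace ℝ d) := by
    refine injOn_collisionCylMap hε u hd1 hd2 ?_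
    rw [h1, h2]
    exact hr'
  have ht₁0 : 0 ≤ t₁ := hτpos.le
  have := congrArg (fun y : EuclideanSpace ℝ d => ‖y‖) heq
  simp only [norm_smul, hνn, hν'n, mul_one, Real.norm_of_nonneg hτ.le, Real.norm_of_nonneg ht₁0] at this
  exact this.symm


/-! ## The parametrized data -/

omit hε hε' in
/-- The collision law is an isometry of the relative velocity:
`‖v_*' - v'‖ = ‖v_* - v‖` (a Householder reflection). [folklore] -/
theorem norm_collide_snd_sub_fst (ν : sphere (0 : EuclideanSpace ℝ d) 1) (p : EuclideanSpace ℝ d × EuclideanSpace ℝ d) :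
    ‖(collide ν p).2 - (collide ν p).1‖ = ‖p.2 - p.1‖ := by
  have hω : ⟪(ν : EuclideanSpace ℝ d), (ν : EuclideanSpace ℝ d)⟫_ℝ = 1 := real_inner_self_sphere ν
  have heq : (collide ν p).2 - (collide ν p).1 = (p.2 - p.1) + (2 * ⟪p.1 - p.2, (ν : EuclideanSpace ℝ d)⟫_ℝ) • (ν : EuclideanSpace ℝ d) := by
    simp only [collide]
    module
  have hsq : ‖(collide ν p).2 - (collide ν p).1‖ ^ 2 = ‖p.2 - p.1‖ ^ 2 := by
    rw [heq, norm_add_sq_real, norm_smul, real_inner_smul_right, Real.norm_eq_abs, mul_pow, sq_abs,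
      norm_eq_of_mem_sphere ν]
    have : ⟪p.2 - p.1, (ν : EuclideanSpace ℝ d)⟫_ℝ = -⟪p.1 - p.2, (ν : EuclideanSpace ℝ d)⟫_ℝ := by
      rw [← inner_neg_left, neg_sub]
    rw [this]
    ring
  have h1 : 0 ≤ ‖(collide ν p).2 - (collide ν p).1‖ := norm_nonneg _
  have h2 : 0 ≤ ‖p.2 - p.1‖ := norm_nonneg _
  nlinarith [hsq]

omit hε hε' in
/-- The velocities of the datum `S_{-τ} (gainConfig Z' i ν v)` of the partner and of the adjoined
sphere are the incoming velocities `(v_i*, v*) = collide ν (v_i, v)`. [folklore] -/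
theorem freeFlight_neg_gainConfig_vel (Z' : Config (s + 1) d (UnitAddTorus d)) (ν : sphere (0 : EuclideanSpace ℝ d) 1)
    (v : EuclideanSpace ℝ d) (τ : ℝ) :
    (freeFlight (Torus.geometry d) (-τ) (gainConfig (Torus.geometry d) ε Z' i ν v) (Fin.castAdd 1 i)).2 = (collide ν ((Z' i).2, v)).1 ∧
    (freeFlight (Torus.geometry d) (-τ) (gainConfig (Torus.geometry d) ε Z' i ν v) (Fin.natAdd (s + 1) 0)).2 = (collide ν ((Z' i).2, v)).2 := by
  constructor
  · rw [freeFlight_apply, gainConfig_apply_castAdd_snd, if_pos rfl, reflectVel_eq_collide]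
  · rw [freeFlight_apply, gainConfig_apply_last, reflectVel_eq_collide]

omit hε hε' in
/-- **The datum `S_{-τ} (gainConfig Z' i ν v)` in the flipped chart**:
`S_{-τ}(gainConfig Z' i ν v) = flipVel (appendParticle W'' (x''_i + proj (ε ν + τ (w'' - v''_i))) w'')` with
`W'' = S_τ (flipVel Z*)`, `w'' = -v*`, `(Z*, v*) = scatterParams i ν (Z', v)` (`freeFlight_neg_gainConfig_eq`,
`freeFlight_lossConfig_torus`). [folklore] -/
theorem freeFlight_neg_gainConfig_eq_flipChart (Z' : Config (s + 1) d (UnitAddTorus d)) (ν : sphere (0 : EuclideanSpace ℝ d) 1)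
    (v : EuclideanSpace ℝ d) (τ : ℝ) :
    freeFlight (Torus.geometry d) (-τ) (gainConfig (Torus.geometry d) ε Z' i ν v) =
      flipVel (appendParticle (freeFlight (Torus.geometry d) τ (flipVel (scatterParams i ν (Z', v)).1))
        ((freeFlight (Torus.geometry d) τ (flipVel (scatterParams i ν (Z', v)).1) i).1 +
          FunctionSpaces.Torus.proj (ε • (ν : EuclideanSpace ℝ d) + τ • (-(scatterParams i ν (Z', v)).2 - (flipVel (scatterParams i ν (Z', v)).1 i).2)))
        (-(scatterParams i ν (Z', v)).2)) := by
  rw [freeFlight_neg_gainConfig_eq, freeFlight_lossConfig_torus]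


/-! ## The single-collision event in collision coordinates -/

/-- **The single-collision event in collision coordinates.** For `0 < ε < 1/2`, a chart radius
`ρ < 1/2` with `ε + δ V ≤ ρ`, a label `i`, and a jointly measurable `H ≥ 0` on
(time) × `Config (s + 2)`: the Lebesgue integral over the single-collision event `E` of the window
`(0, δ]` for the pair (`i`, last sphere), restricted to slow colliding pairs (`‖v_last - v_i‖ ≤ V`),
of `H` read at (collision instant, outgoing collision configuration), equals the integral over the
collision coordinates — the configuration `Z'` of the other spheres at the collision instant with
the outgoing velocity `v_i`, the outgoing velocity `v` and the impact direction `ν` of the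
colliding sphere, the instant `τ ∈ (0, δ]` — of the outgoing flux
`ε^{d-1} (⟪v - v_i, ν⟫)₊` times `1_{‖v - v_i‖ ≤ V} 1_E(S_{-τ}(gainConfig Z' i ν v)) H(τ, lossConfig Z' i ν v)`
(`lintegral_eq_boundaryFlux_backward`; the datum `S_{-τ}(gainConfig Z' i ν v)` of the event has
collision instant `τ`, `collisionInstant_eq_of_chart`, incoming configuration `gainConfig` and
outgoing configuration `outRep ∘ gainConfig = lossConfig`). This is the change of variables to
collision coordinates on the single-collision events of CIP 1994 App. 4.B, with the window and
velocity cut-offs making the torus chart injective. [cite: CIP1994, App. 4.B] -/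
theorem lintegral_singleCollisionEvent_eq [Nonempty d] {ρ δ V : ℝ} (hρ : ρ < 1 / 2) (hδV : ε + δ * V ≤ ρ)
    (H : ℝ → Config (s + 1 + 1) d (UnitAddTorus d) → ℝ≥0∞)
    (hH : Measurable fun p : ℝ × Config (s + 1 + 1) d (UnitAddTorus d) => H p.1 p.2) :
    ∫⁻ z : Config (s + 1 + 1) d (UnitAddTorus d),
        (Alexander.singleCollisionEvent (Torus.geometry d) ε (Fin.castAdd 1 i) (Fin.natAdd (s + 1) 0) δ).indicator
          (fun z => {z : Config (s + 1 + 1) d (UnitAddTorus d) | ‖(z (Fin.natAdd (s + 1) 0)).2 - (z (Fin.castAdd 1 i)).2‖ ≤ V}.indicator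
            (fun z => H (Alexander.collisionInstant (Torus.geometry d) ε z 1).toReal
              (outRep (Torus.geometry d) (s + 1) i
                (freeFlight (Torus.geometry d) (Alexander.collisionInstant (Torus.geometry d) ε z 1).toReal z))) z) z =
      ∫⁻ Z' : Config (s + 1) d (UnitAddTorus d), ∫⁻ v : EuclideanSpace ℝ d,
        ∫⁻ ν : sphere (0 : EuclideanSpace ℝ d) 1, ∫⁻ τ in Ioc (0 : ℝ) δ,
          (collisionCylDom (v - (Z' i).2)).indicator (fun _ => (1 : ℝ≥0∞)) (ν : EuclideanSpace ℝ d) *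
            (ENNReal.ofReal (ε ^ (Fintype.card d - 1) * ⟪v - (Z' i).2, (ν : EuclideanSpace ℝ d)⟫_ℝ) *
              ({v : EuclideanSpace ℝ d | ‖v - (Z' i).2‖ ≤ V}.indicator (fun _ => (1 : ℝ≥0∞)) v *
                ((Alexander.singleCollisionEvent (Torus.geometry d) ε (Fin.castAdd 1 i) (Fin.natAdd (s + 1) 0) δ).indicator
                  (fun _ => (1 : ℝ≥0∞)) (freeFlight (Torus.geometry d) (-τ) (gainConfig (Torus.geometry d) ε Z' i ν v)) *
                  H τ (lossConfig (Torus.geometry d) ε Z' i ν v))))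
          ∂volume ∂(volume : Measure (EuclideanSpace ℝ d)).toSphere := by
  classical
  have hG := Torus.isHardSphereRegular_geometry (d := d) hε'
  have hGm := Torus.isMeasurable_geometry (d := d)
  set G := Torus.geometry d with hGdef
  set E := Alexander.singleCollisionEvent G ε (Fin.castAdd 1 i) (Fin.natAdd (s + 1) 0) δ with hE
  set t₁ : Config (s + 1 + 1) d (UnitAddTorus d) → ℝ := fun z => (Alexander.collisionInstant G ε z 1).toReal with ht₁
  set Sl : Set (Config (s + 1 + 1) d (UnitAddTorus d)) := {z | ‖(z (Fin.natAdd (s + 1) 0)).2 - (z (Fin.castAdd 1 i)).2‖ ≤ V} with hSl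
  set g : Config (s + 1 + 1) d (UnitAddTorus d) → ℝ≥0∞ :=
    fun z => E.indicator (fun z => Sl.indicator (fun z => H (t₁ z) (outRep G (s + 1) i (freeFlight G (t₁ z) z))) z) z with hg
  have hne : (Fin.castAdd 1 i : Fin (s + 1 + 1)) ≠ Fin.natAdd (s + 1) 0 := by
    intro h
    have := congrArg Fin.val h
    simp at this
    omega
  -- measurability of `g`
  have hEm : MeasurableSet E := Alexander.measurableSet_singleCollisionEvent hG hGm (Alexander.measurableSet_good hG hGm) _ _ δ
  have ht₁m : Measurable t₁ := (Alexander.measurable_collisionInstant hG hGm 1).ennreal_toReal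
  have hSlm : MeasurableSet Sl :=
    measurableSet_le (((measurable_pi_apply _).snd.sub (measurable_pi_apply _).snd).norm) measurable_const
  have hinner : Measurable fun z : Config (s + 1 + 1) d (UnitAddTorus d) => H (t₁ z) (outRep G (s + 1) i (freeFlight G (t₁ z) z)) :=
    hH.comp (ht₁m.prodMk ((measurable_outRep hGm (s + 1) i).comp (hGm.measurable_freeFlight₂.comp (ht₁m.prodMk measurable_id))))
  have hgm : Measurable g := (hinner.indicator hSlm).indicator hEm
  -- the chart support condition
  have hg0 : ∀ (W' : Config (s + 1) d (UnitAddTorus d)) (w : EuclideanSpace ℝ d) (r : EuclideanSpace ℝ d),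
      r ∈ Torus.symCube d → r ∉ closedBall (0 : EuclideanSpace ℝ d) ρ ∩ collisionCylRegion ε (w - (W' i).2) →
        g (flipVel (appendParticle W' ((W' i).1 + FunctionSpaces.Torus.proj r) w)) = 0 := by
    intro W' w r hr hnot
    by_contra hne0
    set zz := flipVel (appendParticle W' ((W' i).1 + FunctionSpaces.Torus.proj r) w) with hzz
    have hzzE : zz ∈ E := by
      by_contra h; exact hne0 (by simp only [hg]; exact indicator_of_notMem h _)
    have hzzS : zz ∈ Sl := by
      by_contra h
      exact hne0 (by simp only [hg]; rw [indicator_of_mem hzzE]; exact indicator_of_notMem h _)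
    have hslow : ‖w - (W' i).2‖ ≤ V := by
      have h : ‖(zz (Fin.natAdd (s + 1) 0)).2 - (zz (Fin.castAdd 1 i)).2‖ ≤ V := hzzS
      rw [hzz, flipVel_apply, flipVel_apply, appendParticle_last, appendParticle_castAdd] at h
      have h' : ‖-w - -(W' i).2‖ ≤ V := h
      rwa [show -w - -(W' i).2 = -(w - (W' i).2) by abel, norm_neg] at h'
    obtain ⟨ν, hflux, hreq⟩ := chart_of_mem_singleCollisionEvent hε hε' i hρ hδV W' w r hr hzzE hslow
    obtain ⟨hτpos, hτle, -, -, -⟩ := Alexander.singleCollisionEvent_structure hG hne hzzE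
    apply hnot
    constructor
    · rw [mem_closedBall, dist_zero_right, hreq]
      calc ‖ε • (ν : EuclideanSpace ℝ d) + (Alexander.collisionInstant G ε zz 1).toReal • (w - (W' i).2)‖
          ≤ ‖ε • (ν : EuclideanSpace ℝ d)‖ + ‖(Alexander.collisionInstant G ε zz 1).toReal • (w - (W' i).2)‖ := norm_add_le _ _
        _ = ε + (Alexander.collisionInstant G ε zz 1).toReal * ‖w - (W' i).2‖ := by
            rw [norm_smul, norm_smul, Real.norm_of_nonneg hε.le, Real.norm_of_nonneg hτpos.le, norm_eq_of_mem_sphere ν, mul_one]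
        _ ≤ ε + δ * V := by
            have : (Alexander.collisionInstant G ε zz 1).toReal * ‖w - (W' i).2‖ ≤ δ * V :=
              mul_le_mul hτle hslow (norm_nonneg _) (hτpos.le.trans hτle)
            linarith
        _ ≤ ρ := hδV
    · refine ⟨(Alexander.collisionInstant G ε zz 1).toReal • (ν : EuclideanSpace ℝ d), ?_, ?_⟩
      · show 0 < ⟪w - (W' i).2, (Alexander.collisionInstant G ε zz 1).toReal • (ν : EuclideanSpace ℝ d)⟫_ℝ
        rw [real_inner_smul_right]; exact mul_pos hτpos hflux
      · rw [collisionCylMap_smul_unit ε _ (norm_eq_of_mem_sphere ν) hτpos, hreq]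
  -- the change of variables
  have key := lintegral_eq_boundaryFlux_backward i hε hρ g hgm hg0
  rw [← key]
  refine lintegral_congr fun Z' => lintegral_congr fun v => lintegral_congr fun ν => ?_
  -- the `τ`-integrals
  have hIoc : ∀ F : ℝ → ℝ≥0∞, ∫⁻ τ in Ioc (0 : ℝ) δ, F τ = ∫⁻ τ in Ioi (0 : ℝ), (Iic δ).indicator F τ := by
    intro F
    rw [lintegral_indicator measurableSet_Iic, Measure.restrict_restrict measurableSet_Iic, Iic_inter_Ioi]
  rw [hIoc]
  refine setLIntegral_congr_fun measurableSet_Ioi (fun τ hτ => ?_)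
  have hτ0 : 0 < τ := hτ
  -- the pointwise identity at `τ > 0`
  by_cases hdom : (ν : EuclideanSpace ℝ d) ∈ collisionCylDom (v - (Z' i).2)
  swap
  · rw [indicator_of_notMem hdom]
    by_cases hτδ : τ ∈ Iic δ
    · rw [indicator_of_mem hτδ]; simp
    · rw [indicator_of_notMem hτδ]; simp
  have hflux : 0 < ⟪v - (Z' i).2, (ν : EuclideanSpace ℝ d)⟫_ℝ := hdom
  set zτ := freeFlight G (-τ) (gainConfig G ε Z' i ν v) with hzτ
  -- velocities of the datum and the slow cut-off
  obtain ⟨hvi, hvl⟩ := freeFlight_neg_gainConfig_vel (ε := ε) i Z' ν v τ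
  have hnc := norm_collide_snd_sub_fst (d := d) ν ((Z' i).2, v)
  have hSliff : zτ ∈ Sl ↔ ‖v - (Z' i).2‖ ≤ V := by
    show ‖(zτ (Fin.natAdd (s + 1) 0)).2 - (zτ (Fin.castAdd 1 i)).2‖ ≤ V ↔ _
    rw [hzτ, hvi, hvl, hnc]
  by_cases hslow : ‖v - (Z' i).2‖ ≤ V
  swap
  · -- fast pairs contribute to neither side
    have hg0' : g zτ = 0 := by
      simp only [hg]
      by_cases h : zτ ∈ E
      · rw [indicator_of_mem h, indicator_of_notMem (fun h' => hslow (hSliff.1 h'))]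
      · rw [indicator_of_notMem h]
    have hs0 : ({v : EuclideanSpace ℝ d | ‖v - (Z' i).2‖ ≤ V}).indicator (fun _ => (1 : ℝ≥0∞)) v = 0 :=
      indicator_of_notMem (by exact hslow) _
    rw [hg0', hs0]
    by_cases hτδ : τ ∈ Iic δ
    · rw [indicator_of_mem hτδ]; simp
    · rw [indicator_of_notMem hτδ]; simp
  have hs1 : ({v : EuclideanSpace ℝ d | ‖v - (Z' i).2‖ ≤ V}).indicator (fun _ => (1 : ℝ≥0∞)) v = 1 := indicator_of_mem (by exact hslow) _
  by_cases hzE : zτ ∈ E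
  swap
  · -- data outside the event contribute to neither side
    have hg0' : g zτ = 0 := by simp only [hg]; rw [indicator_of_notMem hzE]
    by_cases hτδ : τ ∈ Iic δ
    · rw [indicator_of_mem hτδ, hg0', indicator_of_notMem hzE]; simp
    · rw [indicator_of_notMem hτδ, hg0']; simp
  -- the datum is in the event, slow, with positive flux: the flipped chart coordinates
  set Zf := flipVel (scatterParams i ν (Z', v)).1 with hZf
  set wf : EuclideanSpace ℝ d := -(scatterParams i ν (Z', v)).2 with hwf
  have hchart := freeFlight_neg_gainConfig_eq_flipChart (ε := ε) i Z' ν v τ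
  have hvelf : (freeFlight G τ Zf i).2 = (Zf i).2 := by rw [freeFlight_apply]
  have hfluxf : 0 < ⟪wf - (freeFlight G τ Zf i).2, (ν : EuclideanSpace ℝ d)⟫_ℝ := by
    rw [hvelf, hwf, hZf, inner_flipScatter]; exact hflux
  have huf : wf - (freeFlight G τ Zf i).2 = -((collide ν ((Z' i).2, v)).2 - (collide ν ((Z' i).2, v)).1) := by
    rw [hvelf, hwf, hZf, flipVel_apply]
    simp only [scatterParams, Function.update_self]
    abel
  have hslowf : ‖wf - (freeFlight G τ Zf i).2‖ ≤ V := by rw [huf, norm_neg, hnc]; exact hslow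
  have hzchart : zτ = flipVel (appendParticle (freeFlight G τ Zf) ((freeFlight G τ Zf i).1 +
      FunctionSpaces.Torus.proj (ε • (ν : EuclideanSpace ℝ d) + τ • (wf - (freeFlight G τ Zf i).2))) wf) := by
    rw [hzτ, hchart, hvelf]
  -- the argument of the chart indicator is the chart coordinate
  have hrarg : ε • (ν : EuclideanSpace ℝ d) - τ • ((collide ν ((Z' i).2, v)).2 - (collide ν ((Z' i).2, v)).1) =
      ε • (ν : EuclideanSpace ℝ d) + τ • (wf - (freeFlight G τ Zf i).2) := by
    rw [huf, smul_neg, sub_eq_add_neg]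
  obtain ⟨hτpos, hτle, -, -, -⟩ := Alexander.singleCollisionEvent_structure hG hne hzE
  by_cases hτδ : τ ≤ δ
  · -- main case: the window contains `τ`
    have hball : ε • (ν : EuclideanSpace ℝ d) + τ • (wf - (freeFlight G τ Zf i).2) ∈ closedBall (0 : EuclideanSpace ℝ d) ρ := by
      rw [mem_closedBall, dist_zero_right]
      calc ‖ε • (ν : EuclideanSpace ℝ d) + τ • (wf - (freeFlight G τ Zf i).2)‖
          ≤ ‖ε • (ν : EuclideanSpace ℝ d)‖ + ‖τ • (wf - (freeFlight G τ Zf i).2)‖ := norm_add_le _ _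
        _ = ε + τ * ‖wf - (freeFlight G τ Zf i).2‖ := by
            rw [norm_smul, norm_smul, Real.norm_of_nonneg hε.le, Real.norm_of_nonneg hτ0.le, norm_eq_of_mem_sphere ν, mul_one]
        _ ≤ ε + δ * V := by
            have : τ * ‖wf - (freeFlight G τ Zf i).2‖ ≤ δ * V := mul_le_mul hτδ hslowf (norm_nonneg _) (hτ0.le.trans hτδ)
            linarith
        _ ≤ ρ := hδV
    have hsym : ε • (ν : EuclideanSpace ℝ d) + τ • (wf - (freeFlight G τ Zf i).2) ∈ Torus.symCube d :=
      Torus.closedBall_subset_symCube hρ hball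
    have hzE' : flipVel (appendParticle (freeFlight G τ Zf) ((freeFlight G τ Zf i).1 +
        FunctionSpaces.Torus.proj (ε • (ν : EuclideanSpace ℝ d) + τ • (wf - (freeFlight G τ Zf i).2))) wf) ∈ E := by rwa [← hzchart]
    have ht₁τ : t₁ zτ = τ := by
      rw [ht₁]
      simp only
      rw [hzchart]
      exact collisionInstant_eq_of_chart hε hε' i hρ hδV (freeFlight G τ Zf) wf ν hτ0 hfluxf hsym hzE' hslowf
    -- the outgoing configuration
    have hout : outRep G (s + 1) i (freeFlight G (t₁ zτ) zτ) = lossConfig G ε Z' i ν v := by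
      rw [ht₁τ, hzτ, ← freeFlight_add, add_neg_cancel, freeFlight_zero, hGdef, outRep_gainConfig_torus hε hε']
    have hgz : g zτ = H τ (lossConfig G ε Z' i ν v) := by
      simp only [hg]
      rw [indicator_of_mem hzE, indicator_of_mem (hSliff.2 hslow), hout, ht₁τ]
    rw [indicator_of_mem (show τ ∈ Iic δ from hτδ), indicator_of_mem hzE, hs1, hrarg, indicator_of_mem hball, hgz]
    ring
  · -- `τ > δ`: the chart indicator vanishes (else the instant would be `τ ≤ δ`)
    have hball : ε • (ν : EuclideanSpace ℝ d) + τ • (wf - (freeFlight G τ Zf i).2) ∉ closedBall (0 : EuclideanSpace ℝ d) ρ := by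
      intro hball
      have hsym : ε • (ν : EuclideanSpace ℝ d) + τ • (wf - (freeFlight G τ Zf i).2) ∈ Torus.symCube d :=
        Torus.closedBall_subset_symCube hρ hball
      have hzE' : flipVel (appendParticle (freeFlight G τ Zf) ((freeFlight G τ Zf i).1 +
          FunctionSpaces.Torus.proj (ε • (ν : EuclideanSpace ℝ d) + τ • (wf - (freeFlight G τ Zf i).2))) wf) ∈ E := by rwa [← hzchart]
      have h := collisionInstant_eq_of_chart hε hε' i hρ hδV (freeFlight G τ Zf) wf ν hτ0 hfluxf hsym hzE' hslowf
      rw [← hzchart] at h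
      exact hτδ (h ▸ hτle)
    rw [indicator_of_notMem (show τ ∉ Iic δ from hτδ), hrarg, indicator_of_notMem hball]
    simp

end Chart

end Kinetic

end

end Literature.MathematicalPhysics.KineticTheory
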